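import Summits.CriticalPhenomena.PercolationContinuityZ3.Theorems.FK.OSSSWiredBoxVariance
import Summits.CriticalPhenomena.PercolationContinuityZ3.Theorems.FK.BlockArmDecoupling
import Summits.CriticalPhenomena.PercolationContinuityZ3.Theorems.FK.FiniteVolumeOneArmThreshold
import Literature.Probability.Percolation.OneArmOSSSDiffIneqZd
import HarnessLib

/-!
# Revealment sums under the wired box measure: arm probabilities at the endpoints against
# `S_n = Σ_{j<n} φ¹_{Λ_{2j}}(0 ↔ ∂Λ_j)`, and the summed one-arm OSSS variance inequality
# (Duminil-Copin–Raoufi–Tassion 2019, §3, proof of Thm 1.2: "Σ_{k=1}^{n−1} μ_n[x ↔ ∂Λ_k(x)] ≤ 2 Σ_{k≤n/2} μ_k[0 ↔ ∂Λ_k] ≤ 2S_n")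

Claimed R42 (8)(c) in the cell INBOX at 2026-08-28T02:11:55Z by fkp-10a gen 352 (NEW CLAIM #2 of the gen), addressed to coordinator fk-4 g266 (seated 01:27Z 2026-08-28; R146 l.8252: row FO-10a-g352 = package g352-osss; its (κ) clause sends the FK instantiation to a new claim, R147); lineage row FO-10a-g352f (self-suggested), package g352-fkosss, label FS-E.
Support file of the `fk-continuity` cell (lineage fkp-10a, `--supports stmt-CriticalPhenomena-4575`); builds on
p205010 (kernel theorem, internal audit signed; external expert review pending).  No definitions, no named facts,
no sorries; standard axioms.  Package `g352-fkosss` = THE FK INSTANTIATION of the OSSS inequality for monotonic measures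
(row FO-10a-g352 `g352-osss`): Duminil-Copin–Raoufi–Tassion's Theorem 1.2 (sharpness of the random-cluster phase
transition on `ℤ^d`, `q ≥ 1`) and, on `ℤ²`, `p_c(q) = √q/(1+√q)`.  UNCONDITIONAL; nothing here touches FH / TP_FK / the
`_r3` binders of the cell.

With `θ_j(p) = φ¹_{Λ_{2j},p,q}(0 ↔ ∂Λ_j)` (the lineage's `regionWiredReal d p q (box d (2j)) (siteToBoundary d j)`),
`S_n = Σ_{j<n} θ_j` and `μ_n = φ¹_{Λ_{2n}}`: (1) COMPARISON BETWEEN BOUNDARY CONDITIONS + TRANSLATION: for `z ∈ Λ_n`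
and `j ≤ n`, `μ_n(armEvent z j) ≤ μ_n(armEvent z (min j ⌊n/2⌋)) ≤ θ_{min j ⌊n/2⌋}` (arm events shrink with the radius
on lattice configurations; the wired measure of `z + Λ_{2j'} ⊆ Λ_{2n}` dominates `μ_n` on increasing events inside it,
`regionWiredReal_anti`, and is the translate of `φ¹_{Λ_{2j'}}` — the tree's `regionWiredReal_armEvent_le` pattern with a
free comparison radius); (2) THE REVEALMENT SUM: `Σ_{k=1}^{n} μ_n(armEvent z |k − ‖z‖|) ≤ 4 S_n` (the Literature's
`OneArmOSSS.sum_Icc_dist_le` for the antitone `j ↦ θ_{min j ⌊n/2⌋}`, and `Σ_{j<n} θ_{min j ⌊n/2⌋} ≤ S_{⌊n/2⌋} + S_{⌊n/2⌋+1}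
≤ 2S_n`); (3) summing the one-sphere inequality of `OSSSWiredBoxVariance.lean` over `k = 1,…,n`:
`n θ_n(1 − θ_n) ≤ 8 S_n Σ_{e ∈ E(Λ_n)} Cov_{μ_n}(𝟙{0 ↔ ∂Λ_n}, ω_e)` (`wiredBox_oneArm_variance_sum_le`; the covariances are
nonnegative by FKG).  Russo's formula for the right-hand side is the next file.  No definitions.

## References
* H. Duminil-Copin, A. Raoufi, V. Tassion, Ann. of Math. 189 (2019) 75–99, §3 proof of Thm 1.2 (display before (3.2)) and
  Lemma 3.2. [DuminilCopinRaoufiTassion2019]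
* G. Grimmett, *The Random-Cluster Model*, Springer 2006, Lemma (4.14)(b), Thm (4.19)(a) proof (4.24) (comparison of
  regions), §4.3 (translations). [Grimmett2006]
-/

noncomputable section

namespace Summit.CriticalPhenomena.PercolationContinuityZ3.Theorems.FK

namespace MonotonicOSSS

open MeasureTheory Finset Function Literature.Probability.ODonnellSaksSchrammServedio2005
open Literature.Probability.Percolation Literature.Probability.LatticeModels
open Literature.Probability.Percolation.GhostExploration Literature.Probability.Percolation.SeedExploration
open Literature.Probability.Percolation.OneArmOSSS Literature.Probability.Percolation.DCT16
open Classical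

variable {d n : ℕ}

/-! ### Arm events shrink with the radius; comparison with a translated smaller box -/

/-- On configurations of lattice edges the arm events decrease with the radius: `armEvent v j ⊆ armEvent v j'` for
`j' ≤ j` (stop the open path at its first exit from `v + Λ_{j'}`). [cite: DuminilCopinRaoufiTassion2019, §3 proof of Thm 1.2 (monotonicity μ_n[x ↔ ∂Λ_k(x)] in k)] -/
theorem armEvent_anti_lattice (hd : 1 ≤ d) {ω : BondConfig (Site d)} (hω : ω ⊆ (zdGraph d).edgeSet) (v : Site d)
    {j j' : ℕ} (hjj' : j' ≤ j) (h : ω ∈ armEvent v j) : ω ∈ armEvent v j' := by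
  obtain ⟨a, ha, hpath⟩ := h
  rw [mem_openConnIn_iff_pathIn] at hpath
  refine armEvent_of_pathIn hω hpath (not_mem_box_or_mem_innerBoundary hd ?_)
  rw [boxNorm_eq_of_mem_innerBoundary ha]
  exact hjj'

/-- `φ¹_{Λ,p,q}(armEvent v j) ≤ φ¹_{Λ,p,q}(armEvent v j')` for `j' ≤ j`. [cite: DuminilCopinRaoufiTassion2019, §3 proof of Thm 1.2 (monotonicity in k)] -/
theorem regionWiredReal_armEvent_anti (hd : 1 ≤ d) {p q : ℝ} (hp : p ∈ Set.Icc (0 : ℝ) 1) (hq : 0 < q)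
    (Λ : Finset (Site d)) (v : Site d) {j j' : ℕ} (hjj' : j' ≤ j) :
    regionWiredReal d p q Λ (armEvent v j) ≤ regionWiredReal d p q Λ (armEvent v j') := by
  rw [regionWiredReal_congr_lattice d hp hq Λ (A := armEvent v j)
    (A' := armEvent v j ∩ {ω | ω ⊆ (zdGraph d).edgeSet})
    (fun ω hω => by simp only [Set.mem_inter_iff, Set.mem_setOf_eq, hω, and_true])]
  exact regionWiredReal_mono_set d hp hq Λ fun ω hω => armEvent_anti_lattice hd hω.2 v hjj' hω.1

/-- COMPARISON + TRANSLATION with a free comparison radius: for `j ≤ M` and `‖z‖_∞ + M ≤ L`,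
`φ¹_{Λ_L,p,q}(armEvent z j) ≤ φ¹_{Λ_M,p,q}(0 ↔ ∂Λ_j)` (`φ¹_{Λ_L} ≤ φ¹_{z + Λ_M}` on increasing events inside `z + Λ_M ⊆ Λ_L`,
then translation by `−z`). [cite: Grimmett2006, Thm (4.19)(a) proof eq. (4.24) and §4.3 (translations); cf. §5.6 (5.98)] -/
theorem regionWiredReal_armEvent_le_box {p q : ℝ} (hp : p ∈ Set.Icc (0 : ℝ) 1) (hq : 1 ≤ q) {j M L : ℕ} (hjM : j ≤ M)
    {z : Site d} (hz : siteRad z + M ≤ L) :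
    regionWiredReal d p q (box d L) (armEvent z j) ≤ regionWiredReal d p q (box d M) (siteToBoundary d j) := by
  have hq0 : 0 < q := one_pos.trans_le hq
  set A : Set (BondConfig (Site d)) := (fun ω => ω ∩ (zdGraph d).edgeSet) ⁻¹' armEvent z j with hA
  have hAup : IsUpperSet A := isUpperSet_preimage_inter_edgeSet (isUpperSet_armEvent' z j)
  have hsub : (box d j).map (Site.shift z).toEmbedding ⊆ (box d M).map (Site.shift z).toEmbedding :=
    Finset.map_subset_map.2 (box_mono d hjM)
  have hAdet : DeterminedBy A ↑(edgesIn (zdGraph d) ((box d M).map (Site.shift z).toEmbedding)) := by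
    refine (determinedBy_preimage_inter_edgeSet (determinedBy_armEvent_map_shift z j)).mono fun e he => ?_
    rw [Finset.mem_coe, mem_edgesIn_iff] at he ⊢
    exact ⟨he.1, fun x hx => hsub (he.2 x hx)⟩
  have hΛ : (box d M).map (Site.shift z).toEmbedding ⊆ box d L := map_shift_box_subset_box hz
  calc regionWiredReal d p q (box d L) (armEvent z j)
      = regionWiredReal d p q (box d L) A := (regionWiredReal_preimage_inter_edgeSet hp hq0 _ _).symm
    _ ≤ regionWiredReal d p q ((box d M).map (Site.shift z).toEmbedding) A :=
        regionWiredReal_anti hp hq hΛ hAup hAdet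
    _ = regionWiredReal d p q ((box d M).map (Site.shift z).toEmbedding) (armEvent z j) :=
        regionWiredReal_preimage_inter_edgeSet hp hq0 _ _
    _ = regionWiredReal d p q (box d M) (siteToBoundary d j) := by
        rw [← preimage_shift_siteToBoundary z j, regionWiredReal_shift (-z) hp hq0, map_shift_map_shift_neg]

/-- THE ARM MAJORANT: for `z ∈ Λ_n` and any `j`, under `μ_n = φ¹_{Λ_{2n}}`,
`μ_n(armEvent z j) ≤ θ_{min j ⌊n/2⌋}`, `θ_i = φ¹_{Λ_{2i}}(0 ↔ ∂Λ_i)`. [cite: DuminilCopinRaoufiTassion2019, §3 proof of Thm 1.2 (μ_n[x ↔ ∂Λ_k(x)] ≤ μ_k[0 ↔ ∂Λ_k] for k ≤ n/2, x ∈ Λ_n)] -/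
theorem regionWiredReal_armEvent_le_theta_min (hd : 1 ≤ d) {p q : ℝ} (hp : p ∈ Set.Icc (0 : ℝ) 1) (hq : 1 ≤ q)
    {z : Site d} (hz : z ∈ box d n) (j : ℕ) :
    regionWiredReal d p q (box d (2 * n)) (armEvent z j)
      ≤ regionWiredReal d p q (box d (2 * min j (n / 2))) (siteToBoundary d (min j (n / 2))) := by
  have hq0 : 0 < q := one_pos.trans_le hq
  have hzn : siteRad z ≤ n := mem_box_iff_siteRad_le.1 hz
  refine (regionWiredReal_armEvent_anti hd hp hq0 _ z (min_le_left j (n / 2))).trans ?_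
  refine regionWiredReal_armEvent_le_box hp hq (Nat.le_mul_of_pos_left _ two_pos) ?_
  have : min j (n / 2) ≤ n / 2 := min_le_right _ _
  omega

/-! ### The revealment sum `Σ_k θ_{min |k − s| ⌊n/2⌋} ≤ 4 S_n` -/

/-- `j ↦ θ_j = φ¹_{Λ_{2j}}(0 ↔ ∂Λ_j)` is antitone. [cite: DuminilCopinRaoufiTassion2019, §3 proof of Thm 1.2 (θ_k non-increasing)] -/
theorem theta_box_antitone (hd : 1 ≤ d) {p q : ℝ} (hp : p ∈ Set.Icc (0 : ℝ) 1) (hq : 1 ≤ q) :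
    Antitone fun j => regionWiredReal d p q (box d (2 * j)) (siteToBoundary d j) := by
  have hq0 : 0 < q := one_pos.trans_le hq
  refine antitone_nat_of_succ_le fun j => ?_
  calc regionWiredReal d p q (box d (2 * (j + 1))) (siteToBoundary d (j + 1))
      ≤ regionWiredReal d p q (box d (2 * (j + 1))) (siteToBoundary d j) := by
        have h := regionWiredReal_armEvent_anti hd hp hq0 (box d (2 * (j + 1))) (0 : Site d) (Nat.le_succ j)
        rwa [armEvent_zero, armEvent_zero] at h
    _ ≤ regionWiredReal d p q (box d (2 * j)) (siteToBoundary d j) :=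
        regionWiredReal_box_siteToBoundary_anti hp hq (by omega) (by omega)

/-- `Σ_{j<n} θ_{min j ⌊n/2⌋} ≤ 2 S_n` (`S_n = Σ_{j<n} θ_j`, `n ≥ 1`): the terms below `⌊n/2⌋` are terms of `S_n`, the
`n − ⌊n/2⌋ ≤ ⌊n/2⌋ + 1` others are each `≤` every one of the first `⌊n/2⌋ + 1 ≤ n` terms.
[cite: DuminilCopinRaoufiTassion2019, §3 proof of Thm 1.2 (Σ_{k=1}^{n−1} μ_n[x↔∂Λ_k(x)] ≤ 2 Σ_{k≤n/2} … ≤ 2S_n)] -/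
theorem sum_theta_min_le (hd : 1 ≤ d) {p q : ℝ} (hp : p ∈ Set.Icc (0 : ℝ) 1) (hq : 1 ≤ q) {n : ℕ} (hn : 1 ≤ n) :
    ∑ j ∈ Finset.range n, regionWiredReal d p q (box d (2 * min j (n / 2))) (siteToBoundary d (min j (n / 2)))
      ≤ 2 * ∑ j ∈ Finset.range n, regionWiredReal d p q (box d (2 * j)) (siteToBoundary d j) := by
  set θ : ℕ → ℝ := fun j => regionWiredReal d p q (box d (2 * j)) (siteToBoundary d j) with hθ
  have hanti : Antitone θ := theta_box_antitone hd hp hq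
  have h0 : ∀ j, 0 ≤ θ j := fun j => by rw [hθ]; exact measureReal_nonneg
  set m := n / 2 with hm
  have hmn : m ≤ n := Nat.div_le_self n 2
  have hsplit := (Finset.sum_range_add_sum_Ico (fun j => θ (min j m)) hmn).symm
  -- the two pieces
  have h1 : ∑ j ∈ Finset.range m, θ (min j m) ≤ ∑ j ∈ Finset.range n, θ j := by
    calc ∑ j ∈ Finset.range m, θ (min j m) = ∑ j ∈ Finset.range m, θ j :=
          Finset.sum_congr rfl fun j hj => by rw [min_eq_left (Finset.mem_range.1 hj).le]
      _ ≤ ∑ j ∈ Finset.range n, θ j :=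
          Finset.sum_le_sum_of_subset_of_nonneg (Finset.range_subset_range.2 hmn) fun j _ _ => h0 j
  have h2 : ∑ j ∈ Finset.Ico m n, θ (min j m) ≤ ∑ j ∈ Finset.range n, θ j := by
    calc ∑ j ∈ Finset.Ico m n, θ (min j m) = ∑ _j ∈ Finset.Ico m n, θ m :=
          Finset.sum_congr rfl fun j hj => by rw [min_eq_right (Finset.mem_Ico.1 hj).1]
      _ = (n - m : ℕ) * θ m := by rw [Finset.sum_const, Nat.card_Ico, nsmul_eq_mul]
      _ ≤ (m + 1 : ℕ) * θ m := mul_le_mul_of_nonneg_right (by exact_mod_cast (by omega : n - m ≤ m + 1)) (h0 m)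
      _ = ∑ _j ∈ Finset.range (m + 1), θ m := by rw [Finset.sum_const, Finset.card_range, nsmul_eq_mul]
      _ ≤ ∑ j ∈ Finset.range (m + 1), θ j := Finset.sum_le_sum fun j hj => hanti (by
          have := Finset.mem_range.1 hj; omega)
      _ ≤ ∑ j ∈ Finset.range n, θ j :=
          Finset.sum_le_sum_of_subset_of_nonneg (Finset.range_subset_range.2 (by omega)) fun j _ _ => h0 j
  change ∑ j ∈ Finset.range n, θ (min j m) ≤ 2 * ∑ j ∈ Finset.range n, θ j
  rw [hsplit]
  linarith

/-- **THE REVEALMENT SUM AT ONE ENDPOINT**: for `z ∈ Λ_n`, `n ≥ 1`,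
`Σ_{k=1}^{n} φ¹_{Λ_{2n}}(armEvent z |k − ‖z‖_∞|) ≤ 4 S_n`, `S_n = Σ_{j<n} φ¹_{Λ_{2j}}(0 ↔ ∂Λ_j)`.
[cite: DuminilCopinRaoufiTassion2019, §3 proof of Lemma 3.2 and of Thm 1.2 (Σ_k μ[u ↔ ∂Λ_k] ≤ 2 max_x Σ_k μ[x ↔ ∂Λ_k(x)] ≤ 4S_n)] -/
theorem sum_Icc_armEvent_le (hd : 1 ≤ d) {p q : ℝ} (hp : p ∈ Set.Icc (0 : ℝ) 1) (hq : 1 ≤ q) {n : ℕ} (hn : 1 ≤ n)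
    {z : Site d} (hz : z ∈ box d n) :
    ∑ k ∈ Finset.Icc 1 n, regionWiredReal d p q (box d (2 * n)) (armEvent z (Nat.dist k (boxNorm z)))
      ≤ 4 * ∑ j ∈ Finset.range n, regionWiredReal d p q (box d (2 * j)) (siteToBoundary d j) := by
  set g : ℕ → ℝ := fun j => regionWiredReal d p q (box d (2 * min j (n / 2))) (siteToBoundary d (min j (n / 2)))
    with hg
  have hganti : Antitone g := fun a b hab =>
    theta_box_antitone hd hp hq (min_le_min_right (n / 2) hab)
  have hg0 : ∀ j, 0 ≤ g j := fun j => by rw [hg]; exact measureReal_nonneg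
  calc ∑ k ∈ Finset.Icc 1 n, regionWiredReal d p q (box d (2 * n)) (armEvent z (Nat.dist k (boxNorm z)))
      ≤ ∑ k ∈ Finset.Icc 1 n, g (Nat.dist k (boxNorm z)) :=
        Finset.sum_le_sum fun k _ => regionWiredReal_armEvent_le_theta_min hd hp hq hz _
    _ ≤ 2 * ∑ j ∈ Finset.range n, g j := sum_Icc_dist_le g hganti hg0 (mem_box_iff_boxNorm_le.1 hz)
    _ ≤ 2 * (2 * ∑ j ∈ Finset.range n, regionWiredReal d p q (box d (2 * j)) (siteToBoundary d j)) :=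
        mul_le_mul_of_nonneg_left (sum_theta_min_le hd hp hq hn) (by norm_num)
    _ = _ := by ring

/-! ### Summing the one-sphere inequality over `k = 1, …, n` -/

/-- **THE SUMMED ONE-ARM OSSS VARIANCE INEQUALITY FOR `μ_n = φ¹_{Λ_{2n}}`** (`d ≥ 1`, `0 < p < 1`, `q ≥ 1`, `n ≥ 1`):
`n · θ_n(1 − θ_n) ≤ 8 S_n · Σ_{e ∈ E(Λ_n)} Cov_{μ_n}(𝟙{0 ↔ ∂Λ_n}, ω_e)` with `θ_n = μ_n(0 ↔ ∂Λ_n)`, `S_n = Σ_{j<n} θ_j`.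
[cite: DuminilCopinRaoufiTassion2019, §3 eq. (3.2) (Σ_e Cov ≥ n/(8S_n) θ_n(1−θ_n))] -/
theorem wiredBox_oneArm_variance_sum_le (hd : 1 ≤ d) {p q : ℝ} (hp : p ∈ Set.Ioo (0 : ℝ) 1) (hq : 1 ≤ q) {n : ℕ}
    (hn : 1 ≤ n) :
    (n : ℝ) * (regionWiredReal d p q (box d (2 * n)) (siteToBoundary d n)
        * (1 - regionWiredReal d p q (box d (2 * n)) (siteToBoundary d n)))
      ≤ 8 * (∑ j ∈ Finset.range n, regionWiredReal d p q (box d (2 * j)) (siteToBoundary d j))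
        * ∑ e : ↥(edgesIn (zdGraph d) (box d n)),
          (regionWiredReal d p q (box d (2 * n)) (siteToBoundary d n ∩ {ω | e.1 ∈ ω})
            - regionWiredReal d p q (box d (2 * n)) (siteToBoundary d n)
              * regionWiredReal d p q (box d (2 * n)) {ω | e.1 ∈ ω}) := by
  have hpI : p ∈ Set.Icc (0 : ℝ) 1 := ⟨hp.1.le, hp.2.le⟩
  have hn2 : n ≤ 2 * n := by omega
  set P : Set (BondConfig (Site d)) → ℝ := fun A => regionWiredReal d p q (box d (2 * n)) A with hP
  set S := ∑ j ∈ Finset.range n, regionWiredReal d p q (box d (2 * j)) (siteToBoundary d j) with hS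
  set C : ↥(edgesIn (zdGraph d) (box d n)) → ℝ := fun e =>
    P (siteToBoundary d n ∩ {ω | e.1 ∈ ω}) - P (siteToBoundary d n) * P {ω | e.1 ∈ ω} with hC
  have hC0 : ∀ e, 0 ≤ C e := fun e => wiredBox_cov_nonneg hp hq hn2 e
  -- one sphere at a time
  have hk : ∀ k ∈ Finset.Icc 1 n, P (siteToBoundary d n) * (1 - P (siteToBoundary d n))
      ≤ ∑ e : ↥(edgesIn (zdGraph d) (box d n)),
        (∑ x ∈ (box d n).filter (fun x => x ∈ (e : Sym2 (Site d))), P (armEvent x (Nat.dist k (boxNorm x)))) * C e := by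
    intro k hk
    rw [Finset.mem_Icc] at hk
    exact wiredBox_oneArm_variance_le hd hp hq hk.1 hk.2 hn2
  -- the revealment sum per edge
  have hR : ∀ e : ↥(edgesIn (zdGraph d) (box d n)), ∑ k ∈ Finset.Icc 1 n,
      ∑ x ∈ (box d n).filter (fun x => x ∈ (e : Sym2 (Site d))), P (armEvent x (Nat.dist k (boxNorm x))) ≤ 8 * S := by
    intro e
    obtain ⟨a, b, hadj, he⟩ := exists_ends e
    rw [Finset.sum_comm]
    simp_rw [he]
    rw [sum_filter_mem_mk hadj.ne a.2 b.2]
    have ha := sum_Icc_armEvent_le hd hpI hq hn a.2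
    have hb := sum_Icc_armEvent_le hd hpI hq hn b.2
    linarith
  calc (n : ℝ) * (P (siteToBoundary d n) * (1 - P (siteToBoundary d n)))
      = ∑ _k ∈ Finset.Icc 1 n, P (siteToBoundary d n) * (1 - P (siteToBoundary d n)) := by
        rw [Finset.sum_const, Nat.card_Icc, Nat.add_sub_cancel, nsmul_eq_mul]
    _ ≤ ∑ k ∈ Finset.Icc 1 n, ∑ e : ↥(edgesIn (zdGraph d) (box d n)),
        (∑ x ∈ (box d n).filter (fun x => x ∈ (e : Sym2 (Site d))), P (armEvent x (Nat.dist k (boxNorm x)))) * C e :=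
        Finset.sum_le_sum hk
    _ = ∑ e : ↥(edgesIn (zdGraph d) (box d n)), (∑ k ∈ Finset.Icc 1 n,
        ∑ x ∈ (box d n).filter (fun x => x ∈ (e : Sym2 (Site d))), P (armEvent x (Nat.dist k (boxNorm x)))) * C e := by
        rw [Finset.sum_comm]; exact Finset.sum_congr rfl fun e _ => by rw [Finset.sum_mul]
    _ ≤ ∑ e : ↥(edgesIn (zdGraph d) (box d n)), (8 * S) * C e :=
        Finset.sum_le_sum fun e _ => mul_le_mul_of_nonneg_right (hR e) (hC0 e)
    _ = 8 * S * ∑ e : ↥(edgesIn (zdGraph d) (box d n)), C e := (Finset.mul_sum _ _ _).symm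

end MonotonicOSSS

end Summit.CriticalPhenomena.PercolationContinuityZ3.Theorems.FK
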